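import Summits.AtomisticToContinuum.HydrodynamicLimit.Theorems.RelayRaceLocalityNearConstantShortTimeHLGeneralFamilyFreeEnergy
import Summits.AtomisticToContinuum.HydrodynamicLimit.Theorems.AntiMazurCoboundariesKineticWindowGronwallActivityInversion
import Summits.AtomisticToContinuum.HydrodynamicLimit.Theorems.JaynesSqueezeHardSphereLDAEos
import Mathlib.Topology.UniformSpace.HeineCantor
import HarnessLib

/-!
# General-family free energy at the thermodynamic activity of a dilute continuous density

Support file for the crux `…Theses.RelayRaceLocality.NearConstantShortTimeHL` (stmt-AtomisticToContinuum-12502),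
line `means-pin-entropy`, stub `stub_ldaGeneralFamilies : GeneralFamilyLDA` (S1 (i)). The diameter sandwich
`tendsto_log_posPartition_of_conjunct` (file `…GeneralFamilyFreeEnergy`) is specialised to the THERMODYNAMIC
ACTIVITIES `α_{σ'}(ρ) = ρ e^{g_{σ'}(ρ)}` (`thermoActivity σ' ρ`, `g_{σ'}(r) = f_ex(rσ'³) + rσ'³f_ex′(rσ'³)`,
`f_ex = hsExcessFreeEnergy`) of ONE continuous density `c ≤ ρ ≤ R` at nearby reduced diameters `σ'`, with the
local-density free energies `V_{σ'}(ρ) = ∫ ρ · ρσ'³ f_ex′(ρσ'³)` as limits. Under the low-density equation of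
state (`f_ex = F` on `[0, η₀)`, `F` analytic — `HsEosLowDensity`) and the packing margin `4Rσ³ ≤ η₀`:

* `exists_delta_comp_cube` — for `g` continuous on `(−η₀, η₀)`, `g(ρ(x)σ'³) → g(ρ(x)σ³)` uniformly in `x` as
  `σ' → σ` (Heine–Cantor on the compact packing window `[cσ³/4, 2Rσ³] ⊂ (0, η₀)`);
* `thermoActivity_eq_of_near`, `continuous_thermoActivity_of_near` — for `|σ' − σ| ≤ σ/4` the activity is
  `ρ e^{G(ρσ'³)}` with the ANALYTIC `G = F + id·F′`, hence continuous, positive, bounded;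
* `tendsto_log_posPartition_thermoActivity` — **conjunct LDA ⟹ general-family LDA, clause (i)**: if
  `(N+1)⁻¹ log Z(α_{σ'}(ρ), hsDiameter σ' N, N+1) → V_{σ'}(ρ)` for all `σ'` near `σ`, then
  `n_N⁻¹ log Z(α_σ(ρ), ε_N, n_N) → V_σ(ρ)` for every admissible family (`ε_N > 0`, `ε_N → 0`, `n_N ε_N³ → σ³`).

No definitions. References: E. Pulvirenti – D. Tsagkarogiannis, Comm. Math. Phys. 316 (2012) Thm 2.1.
-/

noncomputable section

namespace Summit.AtomisticToContinuum.HydrodynamicLimit.Theorems.NearConstantShortTimeHL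

open scoped BigOperators ENNReal Topology
open MeasureTheory Set Filter
open Literature.MathematicalPhysics.KineticTheory Literature.Analysis.FluidPDE Literature.Analysis.FunctionSpaces
open Summit.AtomisticToContinuum.HydrodynamicLimit.Theorems.HardSphereLDA
open Summit.AtomisticToContinuum.HydrodynamicLimit.Theorems.KineticWindowGronwallActivityInversion

/-! ## The packing window -/

/-- For `|σ' − σ| ≤ σ/4` (`σ > 0`): `σ³/4 ≤ σ'³ ≤ 2σ³` and `0 < σ'`. [folklore] -/
theorem cube_window {σ σ' : ℝ} (hσ : 0 < σ) (h : |σ' - σ| ≤ σ / 4) :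
    0 < σ' ∧ σ ^ 3 / 4 ≤ σ' ^ 3 ∧ σ' ^ 3 ≤ 2 * σ ^ 3 := by
  have h1 := abs_le.1 h
  have hlo : 3 * σ / 4 ≤ σ' := by linarith [h1.1]
  have hhi : σ' ≤ 5 * σ / 4 := by linarith [h1.2]
  have hσ'0 : 0 < σ' := by linarith
  refine ⟨hσ'0, ?_, ?_⟩
  · have h3 : (3 * σ / 4) ^ 3 ≤ σ' ^ 3 := pow_le_pow_left₀ (by positivity) hlo 3
    nlinarith [pow_pos hσ 3]
  · have h3 : σ' ^ 3 ≤ (5 * σ / 4) ^ 3 := pow_le_pow_left₀ hσ'0.le hhi 3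
    nlinarith [pow_pos hσ 3]

/-- In the window `|σ' − σ| ≤ σ/4`, for `c ≤ ρ(x) ≤ R` (`0 < c`) and `4Rσ³ ≤ η₀`: the local packing `ρ(x)σ'³`
lies in the compact `[cσ³/4, 2Rσ³] ⊂ (0, η₀)`. [folklore] -/
theorem packing_mem_window {σ σ' : ℝ} (hσ : 0 < σ) (h : |σ' - σ| ≤ σ / 4) {ρ : T3 → ℝ} {c R : ℝ}
    (hc : 0 < c) (hcρ : ∀ x, c ≤ ρ x) (hρR : ∀ x, ρ x ≤ R) (x : T3) :
    ρ x * σ' ^ 3 ∈ Icc (c * σ ^ 3 / 4) (2 * R * σ ^ 3) := by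
  obtain ⟨hσ'0, hlo, hhi⟩ := cube_window hσ h
  have hρ0 : 0 ≤ ρ x := hc.le.trans (hcρ x)
  constructor
  · calc c * σ ^ 3 / 4 = c * (σ ^ 3 / 4) := by ring
      _ ≤ ρ x * σ' ^ 3 := mul_le_mul (hcρ x) hlo (by positivity) hρ0
  · calc ρ x * σ' ^ 3 ≤ R * (2 * σ ^ 3) := mul_le_mul (hρR x) hhi (pow_nonneg hσ'0.le 3) (hρ0.trans (hρR x))
      _ = 2 * R * σ ^ 3 := by ring

/-- The compact packing window sits inside `(0, η₀)` when `4Rσ³ ≤ η₀` (`0 < c ≤ R`). [folklore] -/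
theorem window_subset {σ : ℝ} (hσ : 0 < σ) {c R η₀ : ℝ} (hc : 0 < c) (hcR : c ≤ R) (hR : 4 * R * σ ^ 3 ≤ η₀) :
    Icc (c * σ ^ 3 / 4) (2 * R * σ ^ 3) ⊆ Ioo 0 η₀ := by
  intro η hη
  have hσ3 := pow_pos hσ 3
  have hR0 : 0 < R := hc.trans_le hcR
  exact ⟨lt_of_lt_of_le (by positivity) hη.1, lt_of_le_of_lt hη.2 (by nlinarith)⟩

/-- **Uniform continuity through the cube.** For `g` continuous on `(−η₀, η₀)`, `c ≤ ρ ≤ R`, `4Rσ³ ≤ η₀`: for every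
`e > 0` there is `d > 0` with `|g(ρ(x)σ'³) − g(ρ(x)σ³)| ≤ e` for all `x` whenever `|σ' − σ| < d` (Heine–Cantor on
the packing window). [folklore] -/
theorem exists_delta_comp_cube {η₀ : ℝ} {g : ℝ → ℝ} (hg : ContinuousOn g (Ioo (-η₀) η₀)) {σ : ℝ} (hσ : 0 < σ)
    {ρ : T3 → ℝ} {c R : ℝ} (hc : 0 < c) (hcρ : ∀ x, c ≤ ρ x) (hρR : ∀ x, ρ x ≤ R) (hR : 4 * R * σ ^ 3 ≤ η₀)
    {e : ℝ} (he : 0 < e) :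
    ∃ d : ℝ, 0 < d ∧ ∀ σ' : ℝ, |σ' - σ| < d → ∀ x, |g (ρ x * σ' ^ 3) - g (ρ x * σ ^ 3)| ≤ e := by
  have hcR : c ≤ R := (hcρ 0).trans (hρR 0)
  have hR0 : 0 < R := hc.trans_le hcR
  set K := Icc (c * σ ^ 3 / 4) (2 * R * σ ^ 3) with hK
  have hKsub : K ⊆ Ioo (-η₀) η₀ := fun η hη =>
    ⟨by linarith [(window_subset hσ hc hcR hR hη).1, (window_subset hσ hc hcR hR hη).2],
      (window_subset hσ hc hcR hR hη).2⟩
  have huc : UniformContinuousOn g K := isCompact_Icc.uniformContinuousOn_of_continuous (hg.mono hKsub)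
  obtain ⟨δ₃, hδ₃, h₃⟩ := Metric.uniformContinuousOn_iff.1 huc e he
  -- continuity of the cube at `σ`
  have hcube : ContinuousAt (fun s : ℝ => s ^ 3) σ := (continuous_pow 3).continuousAt
  obtain ⟨δ₄, hδ₄, h₄⟩ := Metric.continuousAt_iff.1 hcube (δ₃ / (R + 1)) (by positivity)
  refine ⟨min (σ / 4) δ₄, lt_min (by positivity) hδ₄, fun σ' hσ' x => ?_⟩
  have hw : |σ' - σ| ≤ σ / 4 := (hσ'.trans_le (min_le_left _ _)).le
  have hw0 : |σ - σ| ≤ σ / 4 := by rw [sub_self, abs_zero]; positivity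
  have hη' : ρ x * σ' ^ 3 ∈ K := packing_mem_window hσ hw hc hcρ hρR x
  have hη : ρ x * σ ^ 3 ∈ K := packing_mem_window hσ hw0 hc hcρ hρR x
  have hd3 : dist (σ' ^ 3) (σ ^ 3) < δ₃ / (R + 1) :=
    h₄ (show dist σ' σ < δ₄ by rw [Real.dist_eq]; exact hσ'.trans_le (min_le_right _ _))
  rw [Real.dist_eq] at hd3
  have hdist : dist (ρ x * σ' ^ 3) (ρ x * σ ^ 3) < δ₃ := by
    rw [Real.dist_eq, ← mul_sub, abs_mul, abs_of_nonneg (hc.le.trans (hcρ x))]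
    calc ρ x * |σ' ^ 3 - σ ^ 3| ≤ R * (δ₃ / (R + 1)) :=
          mul_le_mul (hρR x) hd3.le (abs_nonneg _) hR0.le
      _ < (R + 1) * (δ₃ / (R + 1)) := by gcongr; linarith
      _ = δ₃ := by field_simp
  have h := h₃ _ hη' _ hη hdist
  rw [Real.dist_eq] at h
  exact h.le

/-! ## The thermodynamic activity near `σ` is an analytic function of the density -/

section Eos

variable {η₀ : ℝ} {F : ℝ → ℝ} (hF : AnalyticOnNhd ℝ F (Ioo (-η₀) η₀))
  (hEq : EqOn hsExcessFreeEnergy F (Ico 0 η₀))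
include hF hEq

omit hF in
/-- On `(0, η₀)` the local chemical potential data are the analytic ones: `f_ex(η) = F(η)` and
`f_ex′(η) = F′(η)`. [folklore] -/
theorem eos_eq_of_mem {η : ℝ} (hη : η ∈ Ioo 0 η₀) :
    hsExcessFreeEnergy η = F η ∧ deriv hsExcessFreeEnergy η = deriv F η :=
  ⟨hEq ⟨hη.1.le, hη.2⟩, (hsExcessFreeEnergy_eventuallyEq' hEq hη).deriv_eq⟩

omit hF in
/-- **The thermodynamic activity in the window is `ρ e^{G(ρσ'³)}`** with the analytic `G = F + id·F′`
(`|σ' − σ| ≤ σ/4`, `c ≤ ρ ≤ R`, `4Rσ³ ≤ η₀`). [folklore] -/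
theorem thermoActivity_eq_of_near {σ σ' : ℝ} (hσ : 0 < σ) (h : |σ' - σ| ≤ σ / 4) {ρ : T3 → ℝ} {c R : ℝ}
    (hc : 0 < c) (hcρ : ∀ x, c ≤ ρ x) (hρR : ∀ x, ρ x ≤ R) (hR : 4 * R * σ ^ 3 ≤ η₀) (x : T3) :
    thermoActivity σ' ρ x = ρ x * Real.exp (F (ρ x * σ' ^ 3) + ρ x * σ' ^ 3 * deriv F (ρ x * σ' ^ 3)) := by
  have hcR : c ≤ R := (hcρ 0).trans (hρR 0)
  have hη := window_subset hσ hc hcR hR (packing_mem_window hσ h hc hcρ hρR x)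
  obtain ⟨h1, h2⟩ := eos_eq_of_mem hEq hη
  rw [thermoActivity, h1, h2]

/-- In the window the thermodynamic activity of a continuous density is continuous. [folklore] -/
theorem continuous_thermoActivity_of_near {σ σ' : ℝ} (hσ : 0 < σ) (h : |σ' - σ| ≤ σ / 4) {ρ : T3 → ℝ}
    (hρc : Continuous ρ) {c R : ℝ} (hc : 0 < c) (hcρ : ∀ x, c ≤ ρ x) (hρR : ∀ x, ρ x ≤ R)
    (hR : 4 * R * σ ^ 3 ≤ η₀) : Continuous (thermoActivity σ' ρ) := by
  have hcR : c ≤ R := (hcρ 0).trans (hρR 0)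
  have hfun : thermoActivity σ' ρ = fun x =>
      ρ x * Real.exp (F (ρ x * σ' ^ 3) + ρ x * σ' ^ 3 * deriv F (ρ x * σ' ^ 3)) :=
    funext fun x => thermoActivity_eq_of_near hEq hσ h hc hcρ hρR hR x
  rw [hfun]
  -- `x ↦ ρ(x)σ'³` is continuous with values in `(−η₀, η₀)`, where `F`, `F′` are continuous
  have hηc : Continuous fun x => ρ x * σ' ^ 3 := hρc.mul continuous_const
  have hmem : ∀ x, ρ x * σ' ^ 3 ∈ Ioo (-η₀) η₀ := fun x => by
    have hη := window_subset hσ hc hcR hR (packing_mem_window hσ h hc hcρ hρR x)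
    exact ⟨by linarith [hη.1, hη.2], hη.2⟩
  have hFc : Continuous fun x => F (ρ x * σ' ^ 3) :=
    hF.continuousOn.comp_continuous hηc hmem
  have hF'c : Continuous fun x => deriv F (ρ x * σ' ^ 3) :=
    hF.deriv.continuousOn.comp_continuous hηc hmem
  exact hρc.mul (Real.continuous_exp.comp (hFc.add (hηc.mul hF'c)))

/-- **CONJUNCT LDA ⟹ GENERAL-FAMILY LDA, CLAUSE (i).** Let `f_ex = F` on `[0, η₀)` with `F` analytic on
`(−η₀, η₀)`, `0 < σ < 1/2`, `ρ` continuous with `c ≤ ρ ≤ R` (`0 < c`) and `4Rσ³ ≤ η₀`. If along the conjunct family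
`(N+1)⁻¹ log Z(α_{σ'}(ρ), hsDiameter σ' N, N+1) → V_{σ'}(ρ) = ∫ ρ · ρσ'³f_ex′(ρσ'³)` for every `σ'` with
`|σ' − σ| < δ`, then for every admissible family `(ε_N, n_N)`:
`n_N⁻¹ log Z(α_σ(ρ), ε_N, n_N) → V_σ(ρ)`. [cite: PulvirentiTsagkarogiannis2012, Thm 2.1] -/
theorem tendsto_log_posPartition_thermoActivity {σ : ℝ} (hσ : 0 < σ) (hσ2 : σ < 1 / 2)
    {ρ : T3 → ℝ} (hρc : Continuous ρ) {c R : ℝ} (hc : 0 < c) (hcρ : ∀ x, c ≤ ρ x) (hρR : ∀ x, ρ x ≤ R)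
    (hR : 4 * R * σ ^ 3 ≤ η₀)
    {ε : ℕ → ℝ} {n : ℕ → ℕ} (hε : ∀ N, 0 < ε N) (hε0 : Tendsto ε atTop (𝓝 0))
    (hn : Tendsto (fun N => (n N : ℝ) * ε N ^ 3) atTop (𝓝 (σ ^ 3)))
    {δ : ℝ} (hδ : 0 < δ)
    (hlim : ∀ σ' : ℝ, |σ' - σ| < δ → Tendsto (fun N : ℕ => (((N + 1 : ℕ) : ℝ))⁻¹ *
        Real.log (posPartition (thermoActivity σ' ρ) (hsDiameter σ' N) (N + 1))) atTop
        (𝓝 (∫ x, ρ x * (ρ x * σ' ^ 3 * deriv hsExcessFreeEnergy (ρ x * σ' ^ 3))))) :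
    Tendsto (fun N => (n N : ℝ)⁻¹ * Real.log (posPartition (thermoActivity σ ρ) (ε N) (n N))) atTop
      (𝓝 (∫ x, ρ x * (ρ x * σ ^ 3 * deriv hsExcessFreeEnergy (ρ x * σ ^ 3)))) := by
  have hcR : c ≤ R := (hcρ 0).trans (hρR 0)
  have hR0 : 0 < R := hc.trans_le hcR
  -- shrink the window to `min δ (σ/4)`
  set δ' := min δ (σ / 4) with hδ'
  have hδ'0 : 0 < δ' := lt_min hδ (by positivity)
  have hnear : ∀ σ', |σ' - σ| < δ' → |σ' - σ| ≤ σ / 4 := fun σ' h => (h.trans_le (min_le_right _ _)).le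
  -- the analytic versions of `g` and of the free-energy density
  set G : ℝ → ℝ := fun η => F η + η * deriv F η with hG
  set W : ℝ → ℝ := fun η => η * deriv F η with hW
  have hGc : ContinuousOn G (Ioo (-η₀) η₀) :=
    hF.continuousOn.add (continuousOn_id.mul hF.deriv.continuousOn)
  have hWc : ContinuousOn W (Ioo (-η₀) η₀) := continuousOn_id.mul hF.deriv.continuousOn
  -- the limit functional, rewritten through `W` in the window
  set L : ℝ → ℝ := fun σ' => ∫ x, ρ x * (ρ x * σ' ^ 3 * deriv hsExcessFreeEnergy (ρ x * σ' ^ 3)) with hL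
  have hLW : ∀ σ', |σ' - σ| ≤ σ / 4 → L σ' = ∫ x, ρ x * W (ρ x * σ' ^ 3) := by
    intro σ' h
    rw [hL]
    refine integral_congr_ae (Eventually.of_forall fun x => ?_)
    have hη := window_subset hσ hc hcR hR (packing_mem_window hσ h hc hcρ hρR x)
    simp only [hW]
    rw [(eos_eq_of_mem hEq hη).2]
  have hw0 : |σ - σ| ≤ σ / 4 := by rw [sub_self, abs_zero]; positivity
  refine tendsto_log_posPartition_of_conjunct hσ hσ2 hε hε0 hn hδ'0 (a := fun σ' => thermoActivity σ' ρ)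
    (fun σ' h => (continuous_thermoActivity_of_near hF hEq hσ (hnear σ' h) hρc hc hcρ hρR hR).measurable)
    (fun σ' h x => ?_) (fun σ' h => ?_) (fun e he => ?_) (L := L) ?_
    (fun σ' h => hlim σ' (h.trans_le (min_le_left _ _)))
  · -- positivity
    rw [thermoActivity_eq_of_near hEq hσ (hnear σ' h) hc hcρ hρR hR x]
    exact mul_pos (hc.trans_le (hcρ x)) (Real.exp_pos _)
  · -- boundedness
    obtain ⟨A, -, hA⟩ := exists_forall_abs_le_of_continuous
      (continuous_thermoActivity_of_near hF hEq hσ (hnear σ' h) hρc hc hcρ hρR hR)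
    exact ⟨A, fun x => (le_abs_self _).trans (hA x)⟩
  · -- uniform continuity of `log α_{σ'}(ρ) = log ρ + G(ρσ'³)` in `σ'`
    obtain ⟨d, hd, hdG⟩ := exists_delta_comp_cube hGc hσ hc hcρ hρR hR he
    refine ⟨min d (σ / 4), lt_min hd (by positivity), fun σ' h x => ?_⟩
    have hw : |σ' - σ| ≤ σ / 4 := (h.trans_le (min_le_right _ _)).le
    have hρ0 : 0 < ρ x := hc.trans_le (hcρ x)
    rw [thermoActivity_eq_of_near hEq hσ hw hc hcρ hρR hR x,
      thermoActivity_eq_of_near hEq hσ hw0 hc hcρ hρR hR x,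
      Real.log_mul hρ0.ne' (Real.exp_pos _).ne', Real.log_exp,
      Real.log_mul hρ0.ne' (Real.exp_pos _).ne', Real.log_exp]
    have e1 : Real.log (ρ x) + (F (ρ x * σ' ^ 3) + ρ x * σ' ^ 3 * deriv F (ρ x * σ' ^ 3)) -
        (Real.log (ρ x) + (F (ρ x * σ ^ 3) + ρ x * σ ^ 3 * deriv F (ρ x * σ ^ 3))) =
        G (ρ x * σ' ^ 3) - G (ρ x * σ ^ 3) := by simp only [hG]; ring
    rw [e1]
    exact hdG σ' (h.trans_le (min_le_left _ _)) x
  · -- continuity of `L` at `σ`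
    rw [Metric.continuousAt_iff]
    intro e he
    obtain ⟨d, hd, hdW⟩ := exists_delta_comp_cube hWc hσ hc hcρ hρR hR (e := e / (2 * R)) (by positivity)
    refine ⟨min d (σ / 4), lt_min hd (by positivity), fun σ' h => ?_⟩
    rw [Real.dist_eq] at h
    have hw : |σ' - σ| ≤ σ / 4 := (h.trans_le (min_le_right _ _)).le
    have hmem : ∀ τ, |τ - σ| ≤ σ / 4 → ∀ x, ρ x * τ ^ 3 ∈ Ioo (-η₀) η₀ := fun τ hτ x => by
      have hη := window_subset hσ hc hcR hR (packing_mem_window hσ hτ hc hcρ hρR x)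
      exact ⟨by linarith [hη.1, hη.2], hη.2⟩
    have hint : ∀ τ, |τ - σ| ≤ σ / 4 → Integrable fun x => ρ x * W (ρ x * τ ^ 3) := fun τ hτ =>
      integrable_of_continuous_T3 (hρc.mul (hWc.comp_continuous (hρc.mul continuous_const) (hmem τ hτ)))
    rw [Real.dist_eq, hLW σ' hw, hLW σ hw0, ← integral_sub (hint σ' hw) (hint σ hw0)]
    have hpt : ∀ x, |ρ x * W (ρ x * σ' ^ 3) - ρ x * W (ρ x * σ ^ 3)| ≤ R * (e / (2 * R)) := fun x => by
      rw [← mul_sub, abs_mul, abs_of_nonneg (hc.le.trans (hcρ x))]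
      exact mul_le_mul (hρR x) (hdW σ' (h.trans_le (min_le_left _ _)) x) (abs_nonneg _) hR0.le
    calc |∫ x, ρ x * W (ρ x * σ' ^ 3) - ρ x * W (ρ x * σ ^ 3)|
        ≤ ∫ x, |ρ x * W (ρ x * σ' ^ 3) - ρ x * W (ρ x * σ ^ 3)| := abs_integral_le_integral_abs
      _ ≤ ∫ _ : T3, R * (e / (2 * R)) := integral_mono ((hint σ' hw).sub (hint σ hw0)).abs
          (integrable_const _) hpt
      _ = R * (e / (2 * R)) := by rw [integral_const, smul_eq_mul, probReal_univ, one_mul]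
      _ = e / 2 := by field_simp
      _ < e := by linarith

end Eos

/-- **CONJUNCT LDA ⟹ GENERAL-FAMILY LDA, CLAUSE (i), registered form** (helper stub `generalFamilyFreeEnergyThermo` of
crux stmt-AtomisticToContinuum-12502, line `means-pin-entropy`; the statement of `tendsto_log_posPartition_thermoActivity`
as one closed proposition). [cite: PulvirentiTsagkarogiannis2012, Thm 2.1] -/
theorem generalFamilyFreeEnergyThermo : ∀ {η₀ : ℝ} {F : ℝ → ℝ}, AnalyticOnNhd ℝ F (Set.Ioo (-η₀) η₀) → Set.EqOn hsExcessFreeEnergy F (Set.Ico 0 η₀) → ∀ {σ : ℝ}, 0 < σ → σ < 1 / 2 → ∀ {ρ : T3 → ℝ}, Continuous ρ → ∀ {c R : ℝ}, 0 < c → (∀ x, c ≤ ρ x) → (∀ x, ρ x ≤ R) → 4 * R * σ ^ 3 ≤ η₀ → ∀ {ε : ℕ → ℝ} {n : ℕ → ℕ}, (∀ N, 0 < ε N) → Filter.Tendsto ε Filter.atTop (nhds 0) → Filter.Tendsto (fun N => (n N : ℝ) * ε N ^ 3) Filter.atTop (nhds (σ ^ 3)) → ∀ {δ : ℝ}, 0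 < δ → (∀ σ' : ℝ, |σ' - σ| < δ → Filter.Tendsto (fun N : ℕ => (((N + 1 : ℕ) : ℝ))⁻¹ * Real.log (posPartition (thermoActivity σ' ρ) (hsDiameter σ' N) (N + 1))) Filter.atTop (nhds (∫ x, ρ x * (ρ x * σ' ^ 3 * deriv hsExcessFreeEnergy (ρ x * σ' ^ 3))))) → Filter.Tendsto (fun N => (n N : ℝ)⁻¹ * Real.log (posPartition (thermoActivity σ ρ) (ε N) (n N))) Filter.atTop (nhds (∫ x, ρ x * (ρ x * σ ^ 3 * deriv hsExcessFreeEnergy (ρ x * σ ^ 3)))) :=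
  fun hF hEq _ hσ hσ2 _ hρc _ _ hc hcρ hρR hR _ _ hε hε0 hn _ hδ hlim =>
    tendsto_log_posPartition_thermoActivity hF hEq hσ hσ2 hρc hc hcρ hρR hR hε hε0 hn hδ hlim

end Summit.AtomisticToContinuum.HydrodynamicLimit.Theorems.NearConstantShortTimeHL

end
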